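import Summits.Ventures.Crystal3D.Theorems.StickyWulffConstantTextureBuildHalfDefect
import Summits.Ventures.Crystal3D.Theorems.StickyWulffConstantTextureLiminfTentBarlowBonds
import HarnessLib

/-!
# TB-1 (tiling identity, TB-C core, part 2): the TENT LINE — broken bonds near a free zone against the tent set's own half-defects
# (lane T, crux `TextureLiminfV5`, stmt-Ventures-23912; `stub_textureBuild` → TB-0.md §2 TB-C; cf-p1 DECISION (cxiii) «TB-1 GO»)

HONEST FRAMING. Venture `Summits/Ventures/Crystal3D` (cell `crystal3d-full`), route `route-Ventures-StickyWulffConstant`, helper `--supports` the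
law-v5 crux `TextureLiminfV5` (stmt-Ventures-23912).  Pure finite combinatorics (census-free, standard axioms); nothing about any tent, wall or texture is
claimed; rung F-C1 not moved.

WHAT.  `BarlowFreeCertificate` certifies a grain's free-zone perimeter by `½·brokenNearIn S Xh U` — the broken `S`-bonds of the TENT SET `Xh ⊆ S` (grain atoms,
plus PHANTOMS: crust continuations `Q*`, neighbour grains' balls on `S` across agreement cuts, TB-0.md §6) whose occupied end is within `√2` of the open free zone
`U`.  For the tiling identity (TB-0.md TB-C) this count must be charged to half-defects of balls of the configuration `X'`.  This file proves:
* `brokenNearIn_eq_sum_ncard` — the fibre decomposition `brokenNearIn S Xh U = Σ_{a ∈ Xh, d(a,U) ≤ √2} #{v ∈ S ∖ Xh : |a − v| = 1}`;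
* `brokenNearIn_eq_sum_twelve_sub_cdeg` — `= Σ_{a ∈ Xh, d(a,U) ≤ √2} (12 − cdeg Xh a)` (twelve sites per point of a moved Barlow stacking);
* `twelve_sub_cdeg_le` — for any finite `X'`: `12 − cdeg Xh a ≤ (12 − cdeg X' a) + #{q ∈ X' ∖ Xh : |a − q| = 1}`;
* **`brokenNearIn_le_sum_halfDefect`** — THE TENT LINE:
  `brokenNearIn S Xh U ≤ Σ_{a ∈ Xh ∩ X', near U} 2·halfDefect X' a + crossCount (Xh ∩ X')_{near U} (X' ∖ Xh) + Σ_{a ∈ Xh ∖ X', near U} (12 − cdeg Xh a)`: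
  REAL tent balls pay with their own half-defect plus their bonds to balls outside the tent set (crust / defective neighbours — rim terms of the cover);
  PHANTOM tent balls near `U` are listed separately (the cover keeps phantoms `√2`-away from `U` except along agreement-cut traces, TB-0.md §6).
WHAT THIS IS NOT: no texture, no cover; F-C1 not moved.
-/

noncomputable section

namespace Summit.Ventures.Crystal3D.Theorems

open Finset Summit.Ventures.Crystal3D
open Literature.MathematicalPhysics.StatisticalMechanics (IsHaggSeq contactDeficiency)
open Summit.Ventures.Crystal3D.Cruxes.TextureLiminf.TexShadow (E3 stacking brokenNearIn)
open Summit.Ventures.Crystal3D.TentCertificate (finite_touching stackingBonds stackingBonds_finite brokenNearIn_eq)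

/-! ## The fibre decomposition of the broken-bond set -/

open scoped Classical in
/-- **`brokenNearIn` as a sum over the near-`U` tent points of their vacant-site counts.** -/
theorem brokenNearIn_eq_sum_ncard {L : E3 ≃ₗᵢ[ℝ] E3} {s : E3} {σ : ℤ → ℤ} (hσ : IsHaggSeq σ)
    {Xh : Finset E3} (hXh : (↑Xh : Set E3) ⊆ stacking L s σ) (U : Set E3) :
    (brokenNearIn (stacking L s σ) Xh U : ℝ) =
      ∑ a ∈ Xh.filter (fun a => Metric.infDist a U ≤ Real.sqrt 2),
        ({v : E3 | v ∈ stacking L s σ ∧ dist a v = 1 ∧ v ∉ Xh}.ncard : ℝ) := by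
  set S := stacking L s σ with hS
  have hfin : (stackingBonds S Xh U).Finite := stackingBonds_finite hσ Xh hXh U
  set B : Finset (E3 × E3) := hfin.toFinset with hB
  have hBmem : ∀ p : E3 × E3, p ∈ B ↔ p ∈ stackingBonds S Xh U := fun p => Set.Finite.mem_toFinset hfin
  -- `brokenNearIn = #B`
  have hcard : brokenNearIn S Xh U = B.card := by
    rw [brokenNearIn_eq, hB, Set.ncard_eq_toFinset_card _ hfin]
  -- fibrewise count over the first coordinate
  set A : Finset E3 := Xh.filter (fun a => Metric.infDist a U ≤ Real.sqrt 2) with hA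
  have hmaps : ∀ p ∈ B, p.1 ∈ A := by
    intro p hp
    obtain ⟨h1, -, -, -, hU⟩ := (hBmem p).1 hp
    exact Finset.mem_filter.2 ⟨h1, hU⟩
  have hfib := Finset.card_eq_sum_card_fiberwise hmaps
  rw [hcard, hfib, Nat.cast_sum]
  refine Finset.sum_congr rfl fun a ha => ?_
  -- the fibre over `a` is `{a} × (vacant sites of a)`
  have hset : (↑(B.filter fun p : E3 × E3 => p.1 = a) : Set (E3 × E3)) =
      (Prod.mk a) '' {v : E3 | v ∈ S ∧ dist a v = 1 ∧ v ∉ Xh} := by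
    ext p
    simp only [Finset.coe_filter, Set.mem_setOf_eq, Set.mem_image, hBmem]
    constructor
    · rintro ⟨⟨_, h2, h3, hd, _⟩, rfl⟩
      exact ⟨p.2, ⟨h2, hd, h3⟩, rfl⟩
    · rintro ⟨v, ⟨hv, hd, hvX⟩, rfl⟩
      obtain ⟨haX, haU⟩ := Finset.mem_filter.1 ha
      exact ⟨⟨haX, hv, hvX, hd, haU⟩, rfl⟩
  have hinj : Function.Injective (Prod.mk a : E3 → E3 × E3) := fun v w h => (Prod.mk.inj h).2
  have h := Set.ncard_image_of_injective {v : E3 | v ∈ S ∧ dist a v = 1 ∧ v ∉ Xh} hinj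
  rw [← hset, Set.ncard_coe_finset] at h
  exact_mod_cast h

open scoped Classical in
/-- **`brokenNearIn` in degree currency**: `= Σ_{a ∈ Xh, near U} (12 − cdeg Xh a)` (every point of a moved Barlow stacking has twelve sites). -/
theorem brokenNearIn_eq_sum_twelve_sub_cdeg {L : E3 ≃ₗᵢ[ℝ] E3} {s : E3} {σ : ℤ → ℤ} (hσ : IsHaggSeq σ)
    {Xh : Finset E3} (hXh : (↑Xh : Set E3) ⊆ stacking L s σ) (U : Set E3) :
    (brokenNearIn (stacking L s σ) Xh U : ℝ) =
      ∑ a ∈ Xh.filter (fun a => Metric.infDist a U ≤ Real.sqrt 2), ((12 : ℝ) - (cdeg Xh a : ℝ)) := by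
  rw [brokenNearIn_eq_sum_ncard hσ hXh U]
  refine Finset.sum_congr rfl fun a ha => ?_
  have haX : a ∈ Xh := (Finset.mem_filter.1 ha).1
  have h := card_contacts_add_ncard_vacant hσ hXh haX
  have h' : ((cdeg Xh a : ℕ) : ℝ) + (({y : E3 | y ∈ stacking L s σ ∧ dist a y = 1 ∧ y ∉ Xh}.ncard : ℕ) : ℝ) = 12 := by
    unfold cdeg; exact_mod_cast h
  linarith

/-- Degrees are subadditive along `X' ⊆ Xh ∪ (X' ∖ Xh)`: `12 − cdeg Xh a ≤ (12 − cdeg X' a) + #{q ∈ X' ∖ Xh : |a−q| = 1}`. -/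
theorem twelve_sub_cdeg_le (Xh X' : Finset E3) (a : E3) :
    (12 : ℝ) - (cdeg Xh a : ℝ) ≤ ((12 : ℝ) - (cdeg X' a : ℝ)) + (((X' \ Xh).filter fun q => dist a q = 1).card : ℝ) := by
  classical
  have h : cdeg X' a ≤ cdeg Xh a + ((X' \ Xh).filter fun q => dist a q = 1).card := by
    unfold cdeg
    calc (X'.filter fun q => dist a q = 1).card
        ≤ ((Xh ∪ (X' \ Xh)).filter fun q => dist a q = 1).card :=
          Finset.card_le_card (Finset.filter_subset_filter _ (by
            intro q hq; by_cases h : q ∈ Xh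
            · exact Finset.mem_union_left _ h
            · exact Finset.mem_union_right _ (Finset.mem_sdiff.2 ⟨hq, h⟩)))
      _ ≤ (Xh.filter fun q => dist a q = 1).card + ((X' \ Xh).filter fun q => dist a q = 1).card := by
          rw [Finset.filter_union]; exact Finset.card_union_le _ _
  have h' : (cdeg X' a : ℝ) ≤ (cdeg Xh a : ℝ) + (((X' \ Xh).filter fun q => dist a q = 1).card : ℝ) := by exact_mod_cast h
  linarith

/-! ## The tent line -/

open scoped Classical in
/-- **THE TENT LINE.**  For a tent set `Xh ⊆ S` (a moved Barlow stacking), any finite configuration `X'` and any `U`: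
`brokenNearIn S Xh U ≤ Σ_{a ∈ Xh ∩ X', near U} 2·halfDefect X' a + crossCount ((Xh ∩ X')_{near U}) (X' ∖ Xh) + Σ_{a ∈ Xh ∖ X', near U} (12 − cdeg Xh a)`. -/
theorem brokenNearIn_le_sum_halfDefect {L : E3 ≃ₗᵢ[ℝ] E3} {s : E3} {σ : ℤ → ℤ} (hσ : IsHaggSeq σ)
    {Xh : Finset E3} (hXh : (↑Xh : Set E3) ⊆ stacking L s σ) (X' : Finset E3) (U : Set E3) :
    (brokenNearIn (stacking L s σ) Xh U : ℝ) ≤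
      ∑ a ∈ (Xh ∩ X').filter (fun a => Metric.infDist a U ≤ Real.sqrt 2), 2 * halfDefect X' a +
        (crossCount ((Xh ∩ X').filter (fun a => Metric.infDist a U ≤ Real.sqrt 2)) (X' \ Xh) : ℝ) +
        ∑ a ∈ (Xh \ X').filter (fun a => Metric.infDist a U ≤ Real.sqrt 2), ((12 : ℝ) - (cdeg Xh a : ℝ)) := by
  rw [brokenNearIn_eq_sum_twelve_sub_cdeg hσ hXh U]
  -- split the near-`U` tent points into real and phantom ones
  have hsplit : Xh.filter (fun a => Metric.infDist a U ≤ Real.sqrt 2) =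
      (Xh ∩ X').filter (fun a => Metric.infDist a U ≤ Real.sqrt 2) ∪
        (Xh \ X').filter (fun a => Metric.infDist a U ≤ Real.sqrt 2) := by
    rw [← Finset.filter_union, Finset.union_comm, Finset.sdiff_union_inter]
  have hdisj : Disjoint ((Xh ∩ X').filter (fun a => Metric.infDist a U ≤ Real.sqrt 2))
      ((Xh \ X').filter (fun a => Metric.infDist a U ≤ Real.sqrt 2)) :=
    Finset.disjoint_filter_filter (by
      rw [Finset.disjoint_left]; intro q hq hq'
      exact (Finset.mem_sdiff.1 hq').2 (Finset.mem_inter.1 hq).2)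
  rw [hsplit, Finset.sum_union hdisj, crossCount_eq_sum, Nat.cast_sum]
  have hreal : ∑ a ∈ (Xh ∩ X').filter (fun a => Metric.infDist a U ≤ Real.sqrt 2), ((12 : ℝ) - (cdeg Xh a : ℝ)) ≤
      ∑ a ∈ (Xh ∩ X').filter (fun a => Metric.infDist a U ≤ Real.sqrt 2), 2 * halfDefect X' a +
        ∑ a ∈ (Xh ∩ X').filter (fun a => Metric.infDist a U ≤ Real.sqrt 2),
          ((((X' \ Xh).filter fun q => dist a q = 1).card : ℕ) : ℝ) := by
    rw [← Finset.sum_add_distrib]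
    refine Finset.sum_le_sum fun a _ => ?_
    have h := twelve_sub_cdeg_le Xh X' a
    have h2 : 2 * halfDefect X' a = (12 : ℝ) - (cdeg X' a : ℝ) := by unfold halfDefect; ring
    linarith
  linarith

end Summit.Ventures.Crystal3D.Theorems

end
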